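import Summits.CriticalPhenomena.PercolationContinuityZ3.Theorems.PercNearOneGluingNoHeavyQuantThreeRootHeavySingleStep
import HarnessLib

/-!
# QUANT lane R8, T-DEC: THE HEAVY-SINGLE THREE-TREE SIBLING GROUP INSIDE `GateStepN` — every input of `…QuantThreeRootHeavySingleStep` is an
# oracle call and the floor is the forest's TRUE floor (arm-1 gen 52, architect)

builds on p205010 (kernel theorem, internal audit signed; external expert review pending)

Support file (`--supports stmt-CriticalPhenomena-4575`), QUANT lane seat prim-quant-arm-1 (gen 52, architect); memo
`run/shared/lean/prim/quant/prim-quant-arm-1-g52/ARCH-G52.md` §3.  Theorems only, standard axioms, no sorries.  Sequel of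
`…QuantThreeRootHeavySingleStep` (the five-component identity `threeRoot_gateCoupling_heavySingle` and `sdec_threeRootHeavySingle_of_opened`);
the pattern is arm-1 g46's `…QuantThreeRootGenericOracle` (`treeBuiltN_gate_le` re-gates a tree-built law inside the gate count).

THE THEOREM (`sdec_threeRootHeavySingle_of_oracle`).  In the binder of `LawDec.GateStepN` (lead g42: an oracle giving SDEC of every `TreeBuiltN` law
with `< n` nontrivial gates), take three opened trees `ρᵢ` — `TreeBuiltN yᵢ nᵢ Mᵢ ρᵢ`, `n₁+n₂+n₃+3 ≤ n`, boxes 1 and 2 non-empty (`0 < M₁, M₂`), means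
`Rᵢ` — root gates `0 < q₂ ≤ q₁ < 1` (the light pair), `0 < q₃ < 1` with the HEAVY-SINGLE condition `q₁ + q₂ − q₁q₂ ≤ q₃` (the complement of g46's
`q₃ ≤ Q`) and the BALANCE condition `q₁R₁ + q₂R₂ ≤ q₃·R₁`, `q₁R₁ + q₂R₂ ≤ q₃·R₂`.  THEN the three-tree forest `gate_{q₁}ρ₁ ∗ gate_{q₂}ρ₂ ∗ gate_{q₃}ρ₃`
is SDEC at EVERY floor `0 < x ≤ min(q₁y₁, q₂y₂, q₃y₃)` — the forest's true floor, NO slack condition: the four smaller forests of the step (the opened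
pair `ρ₁ ⊔ gate_{q₂/q₁}ρ₂`; the single opened over the re-gated pair `gate_{q₁/q₃}ρ₁ ⊔ gate_{q₂/q₃}ρ₂ ⊔ ρ₃`; `gate_{η₁}ρ₁ ⊔ ρ₃`; `gate_{η₂}ρ₂ ⊔ ρ₃`,
`ηᵢ = (q₁R₁+q₂R₂)/(q₃Rᵢ) ≤ 1`) are tree-built with fewer than `n` gates at floors whose `q`-multiples dominate `min(qᵢyᵢ)` (`q₃·(qᵢ/q₃) = qᵢ`,
`q₃ηᵢ ≥ qᵢ`).  Exact-LP dichotomy behind the balance condition: ARCH-G52 §3 (for `k = 3` the heavy-single U-law is a mixture of oracle-legal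
product forests iff `ηᵢ ≤ 1`).

HONEST STATUS.  A sub-family of the width-3 core; `GateStepN`, `SiblingStep`, `LightSiblingStep`, `FarTreeRow` remain OPEN; RATE class (log\*) and the
honest sentence of `run/shared/lean/prim/quant/README.md` unchanged.  [this work]; oracle pattern: prim-quant-arm-1 g46 / lead g42 (this lane).
Nothing here is a published result.  The gluing rows served [cite: KozmaNitzan2024, Conjecture 3 (p. 15)]; product measure
[cite: Grimmett1999, §1.3 p. 10].
-/

noncomputable section

namespace Summit.CriticalPhenomena.PercolationContinuityZ3.Theorems

namespace Quant

open Finset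

namespace LawDec

/-! ### Inside `GateStepN`: every input is an oracle call, and the floor is the true floor -/

/-- **THE HEAVY-SINGLE THREE-TREE SIBLING GROUP IS SDEC AT ITS TRUE FLOOR, GIVEN THE ORACLE.**  In the binder of `LawDec.GateStepN` (an oracle
giving SDEC of every `TreeBuiltN` law with `< n` nontrivial gates), three opened trees `ρᵢ` (`TreeBuiltN yᵢ nᵢ Mᵢ ρᵢ`, `n₁+n₂+n₃+3 ≤ n`, boxes 1 and 2
non-empty), root gates `0 < q₂ ≤ q₁ < 1`, `0 < q₃ < 1` with `q₁ + q₂ − q₁q₂ ≤ q₃` (heavy single) and `q₁R₁ + q₂R₂ ≤ q₃R₁`, `q₁R₁ + q₂R₂ ≤ q₃R₂`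
(balanced pair) ⟹ `gate_{q₁}ρ₁ ∗ gate_{q₂}ρ₂ ∗ gate_{q₃}ρ₃` is SDEC at every floor `0 < x ≤ min(q₁y₁, q₂y₂, q₃y₃)`. [this work] -/
theorem sdec_threeRootHeavySingle_of_oracle (n : ℕ) (x y₁ y₂ y₃ q₁ q₂ q₃ R₁ R₂ R₃ : ℝ) (n₁ n₂ n₃ M₁ M₂ M₃ : ℕ) (ρ₁ ρ₂ ρ₃ : ℕ → ℝ)
    (hO : ∀ (x' : ℝ) (n' M' : ℕ) (μ' : ℕ → ℝ), n' < n → TreeBuiltN x' n' M' μ' → SDEC x' M' μ')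
    (hn : n₁ + n₂ + n₃ + 3 ≤ n)
    (h₁ : TreeBuiltN y₁ n₁ M₁ ρ₁) (h₂ : TreeBuiltN y₂ n₂ M₂ ρ₂) (h₃ : TreeBuiltN y₃ n₃ M₃ ρ₃) (hM₁ : 0 < M₁) (hM₂ : 0 < M₂)
    (hR₁ : ∑ h ∈ Finset.range (M₁ + 1), (h : ℝ) * ρ₁ h = R₁) (hR₂ : ∑ h ∈ Finset.range (M₂ + 1), (h : ℝ) * ρ₂ h = R₂)
    (hR₃ : ∑ h ∈ Finset.range (M₃ + 1), (h : ℝ) * ρ₃ h = R₃)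
    (hq₂0 : 0 < q₂) (hq₂₁ : q₂ ≤ q₁) (hq₁1 : q₁ < 1) (hq₃0 : 0 < q₃) (hq₃1 : q₃ < 1) (hQq₃ : q₁ + q₂ - q₁ * q₂ ≤ q₃)
    (hbal₁ : q₁ * R₁ + q₂ * R₂ ≤ q₃ * R₁) (hbal₂ : q₁ * R₁ + q₂ * R₂ ≤ q₃ * R₂)
    (hx0 : 0 < x) (hx₁ : x ≤ q₁ * y₁) (hx₂ : x ≤ q₂ * y₂) (hx₃ : x ≤ q₃ * y₃) :
    SDEC x (M₁ + M₂ + M₃) (lconv (M₁ + M₂) M₃ (lconv M₁ M₂ (gate ρ₁ q₁) (gate ρ₂ q₂)) (gate ρ₃ q₃)) := by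
  obtain ⟨hy₁0, hy₁1, r₁0, r₁M, r₁1, r₁ta⟩ := h₁.lawFacts
  obtain ⟨hy₂0, hy₂1, r₂0, r₂M, r₂1, r₂ta⟩ := h₂.lawFacts
  obtain ⟨hy₃0, hy₃1, r₃0, r₃M, r₃1, r₃ta⟩ := h₃.lawFacts
  rw [hR₁] at r₁ta; rw [hR₂] at r₂ta; rw [hR₃] at r₃ta
  have hS₁ : SDEC y₁ M₁ ρ₁ := hO y₁ n₁ M₁ ρ₁ (by omega) h₁
  have hS₂ : SDEC y₂ M₂ ρ₂ := hO y₂ n₂ M₂ ρ₂ (by omega) h₂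
  have hS₃ : SDEC y₃ M₃ ρ₃ := hO y₃ n₃ M₃ ρ₃ (by omega) h₃
  -- positivity of the pair's means
  have hR₁0 : 0 < R₁ := by
    have h1 : (1 : ℝ) ≤ (M₁ : ℝ) := by exact_mod_cast hM₁
    have h2 : y₁ * 1 ≤ y₁ * (M₁ : ℝ) := mul_le_mul_of_nonneg_left h1 hy₁0.le
    linarith
  have hR₂0 : 0 < R₂ := by
    have h1 : (1 : ℝ) ≤ (M₂ : ℝ) := by exact_mod_cast hM₂
    have h2 : y₂ * 1 ≤ y₂ * (M₂ : ℝ) := mul_le_mul_of_nonneg_left h1 hy₂0.le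
    linarith
  -- elementary gate bounds
  have hq₁0 : 0 < q₁ := lt_of_lt_of_le hq₂0 hq₂₁
  have hq₂1 : q₂ < 1 := lt_of_le_of_lt hq₂₁ hq₁1
  set Q : ℝ := q₁ + q₂ - q₁ * q₂ with hQ
  have hQq₁ : q₁ ≤ Q := by
    have t : 0 ≤ q₂ * (1 - q₁) := mul_nonneg hq₂0.le (by linarith)
    have e : Q - q₁ = q₂ * (1 - q₁) := by rw [hQ]; ring
    linarith
  have hQq₂ : q₂ ≤ Q := by
    have t : 0 ≤ q₁ * (1 - q₂) := mul_nonneg hq₁0.le (by linarith)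
    have e : Q - q₂ = q₁ * (1 - q₂) := by rw [hQ]; ring
    linarith
  have hq₁q₃ : q₁ ≤ q₃ := hQq₁.trans hQq₃
  have hq₂q₃ : q₂ ≤ q₃ := hQq₂.trans hQq₃
  have hr0 : 0 < q₂ / q₁ := div_pos hq₂0 hq₁0
  have hr1 : q₂ / q₁ ≤ 1 := by rw [div_le_one hq₁0]; exact hq₂₁
  have hc₁0 : 0 < q₁ / q₃ := div_pos hq₁0 hq₃0
  have hc₁1 : q₁ / q₃ ≤ 1 := by rw [div_le_one hq₃0]; exact hq₁q₃
  have hc₂0 : 0 < q₂ / q₃ := div_pos hq₂0 hq₃0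
  have hc₂1 : q₂ / q₃ ≤ 1 := by rw [div_le_one hq₃0]; exact hq₂q₃
  set m : ℝ := q₁ * R₁ + q₂ * R₂ with hmdef
  have hm0 : 0 < m := by rw [hmdef]; exact add_pos (mul_pos hq₁0 hR₁0) (mul_pos hq₂0 hR₂0)
  set η₁ : ℝ := m / (q₃ * R₁) with hη₁
  set η₂ : ℝ := m / (q₃ * R₂) with hη₂
  have hη₁0 : 0 < η₁ := div_pos hm0 (mul_pos hq₃0 hR₁0)
  have hη₂0 : 0 < η₂ := div_pos hm0 (mul_pos hq₃0 hR₂0)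
  have hη₁1 : η₁ ≤ 1 := by rw [hη₁, div_le_one (mul_pos hq₃0 hR₁0)]; exact hbal₁
  have hη₂1 : η₂ ≤ 1 := by rw [hη₂, div_le_one (mul_pos hq₃0 hR₂0)]; exact hbal₂
  -- the raised gates dominate the original ones: `q₃ η₁ ≥ q₁`, `q₃ η₂ ≥ q₂`
  have hη₁q : q₁ ≤ q₃ * η₁ := by
    have e : q₃ * η₁ = m / R₁ := by rw [hη₁]; field_simp
    rw [e, le_div_iff₀ hR₁0, hmdef]; linarith [mul_pos hq₂0 hR₂0]
  have hη₂q : q₂ ≤ q₃ * η₂ := by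
    have e : q₃ * η₂ = m / R₂ := by rw [hη₂]; field_simp
    rw [e, le_div_iff₀ hR₂0, hmdef]; linarith [mul_pos hq₁0 hR₁0]
  -- (1) the opened pair `ρ₁ ⊔ gate_{q₂/q₁}ρ₂`, floor `w₁₂ = min(y₁, (q₂/q₁)y₂)`, `≤ n₁ + n₂ + 1` gates
  set w₁₂ : ℝ := min y₁ (q₂ / q₁ * y₂) with hw₁₂
  have hw₁₂0 : 0 < w₁₂ := lt_min hy₁0 (mul_pos hr0 hy₂0)
  have hw₁₂y₁ : w₁₂ ≤ y₁ := min_le_left _ _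
  have hw₁₂1 : w₁₂ < 1 := lt_of_le_of_lt hw₁₂y₁ hy₁1
  have hG₁₂ : SDEC w₁₂ (M₁ + M₂) (lconv M₁ M₂ ρ₁ (gate ρ₂ (q₂ / q₁))) := by
    have hb : TreeBuiltN (w₁₂ / (q₂ / q₁)) n₂ M₂ ρ₂ := by
      refine TreeBuiltN.mono h₂ (div_pos hw₁₂0 hr0) ?_
      rw [div_le_iff₀ hr0]
      calc w₁₂ ≤ q₂ / q₁ * y₂ := min_le_right _ _
        _ = y₂ * (q₂ / q₁) := mul_comm _ _
    obtain ⟨n₂', hn₂', hg⟩ := treeBuiltN_gate_le w₁₂ (q₂ / q₁) n₂ M₂ ρ₂ hr0 hr1 hb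
    have ha : TreeBuiltN w₁₂ n₁ M₁ ρ₁ := TreeBuiltN.mono h₁ hw₁₂0 hw₁₂y₁
    exact hO w₁₂ (n₁ + n₂') (M₁ + M₂) _ (by omega) (TreeBuiltN.conv ha hg)
  have htaG₁₂ : w₁₂ * ((M₁ + M₂ : ℕ) : ℝ) ≤ R₁ + q₂ / q₁ * R₂ := by
    have e1 : w₁₂ * (M₁ : ℝ) ≤ R₁ := (mul_le_mul_of_nonneg_right hw₁₂y₁ (Nat.cast_nonneg M₁)).trans r₁ta
    have e2 : w₁₂ * (M₂ : ℝ) ≤ q₂ / q₁ * R₂ := by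
      calc w₁₂ * (M₂ : ℝ) ≤ (q₂ / q₁ * y₂) * (M₂ : ℝ) := mul_le_mul_of_nonneg_right (min_le_right _ _) (Nat.cast_nonneg M₂)
        _ = q₂ / q₁ * (y₂ * (M₂ : ℝ)) := by ring
        _ ≤ q₂ / q₁ * R₂ := mul_le_mul_of_nonneg_left r₂ta hr0.le
    push_cast
    linarith
  -- (2) the V forest `gate_{q₁/q₃}ρ₁ ⊔ gate_{q₂/q₃}ρ₂ ⊔ ρ₃`, floor `v = min(y₃, (q₁/q₃)y₁, (q₂/q₃)y₂)`, `≤ n₁ + n₂ + n₃ + 2` gates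
  set v : ℝ := min y₃ (min (q₁ / q₃ * y₁) (q₂ / q₃ * y₂)) with hv
  have hv0 : 0 < v := lt_min hy₃0 (lt_min (mul_pos hc₁0 hy₁0) (mul_pos hc₂0 hy₂0))
  have hvy₃ : v ≤ y₃ := min_le_left _ _
  have hv1 : v < 1 := lt_of_le_of_lt hvy₃ hy₃1
  have hvc₁ : v ≤ q₁ / q₃ * y₁ := (min_le_right _ _).trans (min_le_left _ _)
  have hvc₂ : v ≤ q₂ / q₃ * y₂ := (min_le_right _ _).trans (min_le_right _ _)
  have hV : SDEC v (M₁ + M₂ + M₃) (lconv (M₁ + M₂) M₃ (lconv M₁ M₂ (gate ρ₁ (q₁ / q₃)) (gate ρ₂ (q₂ / q₃))) ρ₃) := by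
    have hb₁ : TreeBuiltN (v / (q₁ / q₃)) n₁ M₁ ρ₁ := by
      refine TreeBuiltN.mono h₁ (div_pos hv0 hc₁0) ?_
      rw [div_le_iff₀ hc₁0]; calc v ≤ q₁ / q₃ * y₁ := hvc₁
        _ = y₁ * (q₁ / q₃) := mul_comm _ _
    have hb₂ : TreeBuiltN (v / (q₂ / q₃)) n₂ M₂ ρ₂ := by
      refine TreeBuiltN.mono h₂ (div_pos hv0 hc₂0) ?_
      rw [div_le_iff₀ hc₂0]; calc v ≤ q₂ / q₃ * y₂ := hvc₂
        _ = y₂ * (q₂ / q₃) := mul_comm _ _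
    obtain ⟨n₁', hn₁', hg₁⟩ := treeBuiltN_gate_le v (q₁ / q₃) n₁ M₁ ρ₁ hc₁0 hc₁1 hb₁
    obtain ⟨n₂', hn₂', hg₂⟩ := treeBuiltN_gate_le v (q₂ / q₃) n₂ M₂ ρ₂ hc₂0 hc₂1 hb₂
    have h₃' : TreeBuiltN v n₃ M₃ ρ₃ := TreeBuiltN.mono h₃ hv0 hvy₃
    exact hO v (n₁' + n₂' + n₃) (M₁ + M₂ + M₃) _ (by omega) (TreeBuiltN.conv (TreeBuiltN.conv hg₁ hg₂) h₃')
  have htaV : v * ((M₁ + M₂ + M₃ : ℕ) : ℝ) ≤ q₁ / q₃ * R₁ + q₂ / q₃ * R₂ + R₃ := by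
    have e1 : v * (M₁ : ℝ) ≤ q₁ / q₃ * R₁ := by
      calc v * (M₁ : ℝ) ≤ (q₁ / q₃ * y₁) * (M₁ : ℝ) := mul_le_mul_of_nonneg_right hvc₁ (Nat.cast_nonneg M₁)
        _ = q₁ / q₃ * (y₁ * (M₁ : ℝ)) := by ring
        _ ≤ q₁ / q₃ * R₁ := mul_le_mul_of_nonneg_left r₁ta hc₁0.le
    have e2 : v * (M₂ : ℝ) ≤ q₂ / q₃ * R₂ := by
      calc v * (M₂ : ℝ) ≤ (q₂ / q₃ * y₂) * (M₂ : ℝ) := mul_le_mul_of_nonneg_right hvc₂ (Nat.cast_nonneg M₂)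
        _ = q₂ / q₃ * (y₂ * (M₂ : ℝ)) := by ring
        _ ≤ q₂ / q₃ * R₂ := mul_le_mul_of_nonneg_left r₂ta hc₂0.le
    have e3 : v * (M₃ : ℝ) ≤ R₃ := (mul_le_mul_of_nonneg_right hvy₃ (Nat.cast_nonneg M₃)).trans r₃ta
    push_cast
    linarith
  -- (3) the V₁ forest `gate_{η₁}ρ₁ ⊔ ρ₃`, floor `v₁ = min(y₃, η₁ y₁)`, `≤ n₁ + n₃ + 1` gates
  set v₁ : ℝ := min y₃ (η₁ * y₁) with hv₁
  have hv₁0 : 0 < v₁ := lt_min hy₃0 (mul_pos hη₁0 hy₁0)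
  have hv₁y₃ : v₁ ≤ y₃ := min_le_left _ _
  have hv₁1 : v₁ < 1 := lt_of_le_of_lt hv₁y₃ hy₃1
  have hv₁e : v₁ ≤ η₁ * y₁ := min_le_right _ _
  have hV₁ : SDEC v₁ (M₁ + M₃) (lconv M₁ M₃ (gate ρ₁ η₁) ρ₃) := by
    have hb₁ : TreeBuiltN (v₁ / η₁) n₁ M₁ ρ₁ := by
      refine TreeBuiltN.mono h₁ (div_pos hv₁0 hη₁0) ?_
      rw [div_le_iff₀ hη₁0]; calc v₁ ≤ η₁ * y₁ := hv₁e
        _ = y₁ * η₁ := mul_comm _ _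
    obtain ⟨n₁', hn₁', hg₁⟩ := treeBuiltN_gate_le v₁ η₁ n₁ M₁ ρ₁ hη₁0 hη₁1 hb₁
    have h₃' : TreeBuiltN v₁ n₃ M₃ ρ₃ := TreeBuiltN.mono h₃ hv₁0 hv₁y₃
    exact hO v₁ (n₁' + n₃) (M₁ + M₃) _ (by omega) (TreeBuiltN.conv hg₁ h₃')
  have htaV₁ : v₁ * ((M₁ + M₃ : ℕ) : ℝ) ≤ η₁ * R₁ + R₃ := by
    have e1 : v₁ * (M₁ : ℝ) ≤ η₁ * R₁ := by
      calc v₁ * (M₁ : ℝ) ≤ (η₁ * y₁) * (M₁ : ℝ) := mul_le_mul_of_nonneg_right hv₁e (Nat.cast_nonneg M₁)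
        _ = η₁ * (y₁ * (M₁ : ℝ)) := by ring
        _ ≤ η₁ * R₁ := mul_le_mul_of_nonneg_left r₁ta hη₁0.le
    have e3 : v₁ * (M₃ : ℝ) ≤ R₃ := (mul_le_mul_of_nonneg_right hv₁y₃ (Nat.cast_nonneg M₃)).trans r₃ta
    push_cast
    linarith
  -- (4) the V₂ forest `gate_{η₂}ρ₂ ⊔ ρ₃`, floor `v₂ = min(y₃, η₂ y₂)`, `≤ n₂ + n₃ + 1` gates
  set v₂ : ℝ := min y₃ (η₂ * y₂) with hv₂
  have hv₂0 : 0 < v₂ := lt_min hy₃0 (mul_pos hη₂0 hy₂0)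
  have hv₂y₃ : v₂ ≤ y₃ := min_le_left _ _
  have hv₂1 : v₂ < 1 := lt_of_le_of_lt hv₂y₃ hy₃1
  have hv₂e : v₂ ≤ η₂ * y₂ := min_le_right _ _
  have hV₂ : SDEC v₂ (M₂ + M₃) (lconv M₂ M₃ (gate ρ₂ η₂) ρ₃) := by
    have hb₂ : TreeBuiltN (v₂ / η₂) n₂ M₂ ρ₂ := by
      refine TreeBuiltN.mono h₂ (div_pos hv₂0 hη₂0) ?_
      rw [div_le_iff₀ hη₂0]; calc v₂ ≤ η₂ * y₂ := hv₂e
        _ = y₂ * η₂ := mul_comm _ _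
    obtain ⟨n₂', hn₂', hg₂⟩ := treeBuiltN_gate_le v₂ η₂ n₂ M₂ ρ₂ hη₂0 hη₂1 hb₂
    have h₃' : TreeBuiltN v₂ n₃ M₃ ρ₃ := TreeBuiltN.mono h₃ hv₂0 hv₂y₃
    exact hO v₂ (n₂' + n₃) (M₂ + M₃) _ (by omega) (TreeBuiltN.conv hg₂ h₃')
  have htaV₂ : v₂ * ((M₂ + M₃ : ℕ) : ℝ) ≤ η₂ * R₂ + R₃ := by
    have e1 : v₂ * (M₂ : ℝ) ≤ η₂ * R₂ := by
      calc v₂ * (M₂ : ℝ) ≤ (η₂ * y₂) * (M₂ : ℝ) := mul_le_mul_of_nonneg_right hv₂e (Nat.cast_nonneg M₂)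
        _ = η₂ * (y₂ * (M₂ : ℝ)) := by ring
        _ ≤ η₂ * R₂ := mul_le_mul_of_nonneg_left r₂ta hη₂0.le
    have e3 : v₂ * (M₃ : ℝ) ≤ R₃ := (mul_le_mul_of_nonneg_right hv₂y₃ (Nat.cast_nonneg M₃)).trans r₃ta
    push_cast
    linarith
  -- the floor: the true floor suffices
  have hx₁₂ : x ≤ q₁ * w₁₂ := by
    rw [hw₁₂]
    rcases le_total y₁ (q₂ / q₁ * y₂) with hcase | hcase
    · rw [min_eq_left hcase]; exact hx₁
    · rw [min_eq_right hcase]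
      have e : q₁ * (q₂ / q₁ * y₂) = q₂ * y₂ := by field_simp
      rw [e]; exact hx₂
  have hxv : x ≤ q₃ * v := by
    have e₁ : q₃ * (q₁ / q₃ * y₁) = q₁ * y₁ := by field_simp
    have e₂ : q₃ * (q₂ / q₃ * y₂) = q₂ * y₂ := by field_simp
    rw [hv]
    rcases le_total y₃ (min (q₁ / q₃ * y₁) (q₂ / q₃ * y₂)) with hc | hc
    · rw [min_eq_left hc]; exact hx₃
    · rw [min_eq_right hc]
      rcases le_total (q₁ / q₃ * y₁) (q₂ / q₃ * y₂) with hc' | hc'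
      · rw [min_eq_left hc', e₁]; exact hx₁
      · rw [min_eq_right hc', e₂]; exact hx₂
  have hxv₁ : x ≤ q₃ * v₁ := by
    rw [hv₁]
    rcases le_total y₃ (η₁ * y₁) with hc | hc
    · rw [min_eq_left hc]; exact hx₃
    · rw [min_eq_right hc]
      calc x ≤ q₁ * y₁ := hx₁
        _ ≤ (q₃ * η₁) * y₁ := mul_le_mul_of_nonneg_right hη₁q hy₁0.le
        _ = q₃ * (η₁ * y₁) := by ring
  have hxv₂ : x ≤ q₃ * v₂ := by
    rw [hv₂]
    rcases le_total y₃ (η₂ * y₂) with hc | hc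
    · rw [min_eq_left hc]; exact hx₃
    · rw [min_eq_right hc]
      calc x ≤ q₂ * y₂ := hx₂
        _ ≤ (q₃ * η₂) * y₂ := mul_le_mul_of_nonneg_right hη₂q hy₂0.le
        _ = q₃ * (η₂ * y₂) := by ring
  exact sdec_threeRootHeavySingle_of_opened y₁ y₂ y₃ w₁₂ v v₁ v₂ x q₁ q₂ q₃ Q R₁ R₂ R₃ η₁ η₂ M₁ M₂ M₃ ρ₁ ρ₂ ρ₃
    hy₁0 hy₁1 hy₂0 hy₂1 hy₃0 hy₃1 hw₁₂0.le hw₁₂1 hv0.le hv1 hv₁0.le hv₁1 hv₂0.le hv₂1 hq₂0 hq₂₁ hq₁1 hq₃0 hq₃1 hQ hQq₃ hx0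
    r₁0 r₁M r₁1 hR₁ r₁ta hR₁0 r₂0 r₂M r₂1 hR₂ r₂ta hR₂0 r₃0 r₃M r₃1 hR₃ r₃ta hS₁ hS₂ hS₃
    (by rw [hη₁, hmdef]) (by rw [hη₂, hmdef]) hη₁1 hη₂1 hG₁₂ htaG₁₂ hV htaV hV₁ htaV₁ hV₂ htaV₂ hx₁ hx₂ hx₃ hx₁₂ hxv hxv₁ hxv₂

end LawDec

end Quant

end Summit.CriticalPhenomena.PercolationContinuityZ3.Theorems
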